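import Literature.Probability.RandomPlanarGeometry.RestrictionMapReflection
import Literature.Probability.RandomPlanarGeometry.CaratheodoryHalfPlaneProofs
import Mathlib.Analysis.Calculus.InverseFunctionTheorem.Deriv
import HarnessLib

/-!
# Stub `stub_flatUniformizerDeriv` of line `pin-the-shear` (crux stmt-CriticalPhenomena-14221,
# `Theses.SAWPhaseRetrieval.HexTransfer`)

**Regularity of a chordal uniformizing map at a flat marked point.** Let `(F; a, b)` be a
Dobrushin domain with `a = F.pt 0 = 0` which coincides with the upper half-plane `ℍ` in a ball
`B(0, r₀)`, and let `φ : ℍ → F` be a chordal uniformizing map (`φ(0) = a`, `φ(∞) = b`). Then there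
is `c > 0` with `φ(z)/z → c` as `z → 0` in `ℍ` and `φ⁻¹(w)/w → c⁻¹` as `w → 0` in `F`.

Proof. Carathéodory (`JordanDomain.continuousOn_boundaryExtension_holds`,
`JordanDomain.exists_hasBoundaryValue_holds`): the boundary extension `G` of `φ` is continuous on
`closure ℍ`, `G 0 = a = 0`, and real points go to `∂F`; near `0`, `∂F ⊆ ℝ` (flatness), so `G` is
real on a real segment about `0`, and `φ = G` has positive imaginary part on a half-disc (its
values lie in `F ∩ B(0, r₀) = ℍ ∩ B(0, r₀)`). Schwarz reflection
(`SchwarzReflection.differentiableOn_reflect`) gives a holomorphic `Fr` on `B(0, r)` with `Fr = φ`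
on the upper half-disc and `Fr 0 = 0`; `d = Fr'(0)` is real and nonzero (`deriv_reflection_real`)
and `re d ≥ 0` (approach along `it`), so `d = c > 0` and `φ(z)/z = Fr(z)/z → c`. For the inverse:
`Fr` is strictly differentiable at `0` with `Fr'(0) ≠ 0`, so it has a local inverse `g` with
`g'(0) = c⁻¹` (`HasStrictDerivAt.to_localInverse`); since `Fr` maps the lower half-disc to the
lower half-plane and the real segment to `ℝ`, `g w ∈ ℍ` for `w ∈ F` near `0`, whence
`φ⁻¹ w = g w` and `φ⁻¹(w)/w = g(w)/w → c⁻¹`.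

References: Ch. Pommerenke, *Boundary Behaviour of Conformal Maps* (1992), Thm. 2.1 and §1.2;
J. B. Conway, *Functions of One Complex Variable* (1973), Ch. IX Thm. 1.1 (Schwarz reflection).
-/

noncomputable section

namespace Summit.CriticalPhenomena.SAWScalingLimit.Cruxes.HexTransfer.PinTheShear

open MeasureTheory Filter Topology Set Metric Complex
open scoped NNReal ENNReal ComplexConjugate
open Literature.Probability.RandomPlanarGeometry
open UpperHalfPlane (upperHalfPlaneSet isOpen_upperHalfPlaneSet)

/-- If an open set `U` coincides with `ℍ` inside the ball `B(0, r₀)`, then its frontier inside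
that ball lies on the real axis. [folklore] -/
theorem im_eq_zero_of_mem_frontier_of_inter_ball_eq {U : Set ℂ} (hU : IsOpen U) {r₀ : ℝ}
    (hflat : U ∩ ball (0 : ℂ) r₀ = upperHalfPlaneSet ∩ ball (0 : ℂ) r₀) {p : ℂ}
    (hp : p ∈ frontier U) (hpr : p ∈ ball (0 : ℂ) r₀) : p.im = 0 := by
  rw [frontier, hU.interior_eq] at hp
  have hcl : p ∈ closure (upperHalfPlaneSet ∩ ball (0 : ℂ) r₀) := by
    rw [← hflat]
    exact isOpen_ball.closure_inter ⟨hp.1, hpr⟩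
  have hge : 0 ≤ p.im :=
    (mem_closure_upperHalfPlaneSet_iff).1 (closure_mono inter_subset_left hcl)
  rcases hge.lt_or_eq with hlt | heq
  · exfalso
    have : p ∈ U ∩ ball (0 : ℂ) r₀ := by
      rw [hflat]
      exact ⟨hlt, hpr⟩
    exact hp.2 this.1
  · exact heq.symm

/-- **Regularity of a chordal uniformizing map at a flat marked point** (stub 4c of line
`pin-the-shear`). For a Dobrushin domain `F` with `F.pt 0 = 0` coinciding with `ℍ` in `B(0, r₀)`
and a chordal uniformizing map `φ : ℍ → F`, there is `c > 0` with `φ z / z → c` (`z → 0` in `ℍ`)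
and `φ⁻¹ w / w → c⁻¹` (`w → 0` in `F`): Carathéodory continuity up to the boundary, Schwarz
reflection across the flat boundary segment, `Fr'(0)` real, nonzero and of nonnegative real
part, and the local analytic inverse of the reflected map. [folklore] -/
theorem stub_flatUniformizerDeriv :
    ∀ (F : DobrushinDomain) (r₀ : ℝ), 0 < r₀ → F.pt 0 = 0 →
      F.carrier ∩ Metric.ball (0 : ℂ) r₀ =
        UpperHalfPlane.upperHalfPlaneSet ∩ Metric.ball (0 : ℂ) r₀ →
      ∀ φ : ConformalEquiv UpperHalfPlane.upperHalfPlaneSet F.carrier, F.IsChordalUniformizing φ →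
        ∃ c : ℝ, 0 < c ∧
          Tendsto (fun z : ℂ => φ z / z) (𝓝[UpperHalfPlane.upperHalfPlaneSet] 0) (𝓝 (c : ℂ)) ∧
          Tendsto (fun w : ℂ => φ.symm w / w) (𝓝[F.carrier] 0) (𝓝 ((c : ℂ)⁻¹)) := by
  intro F r₀ hr₀ hpt hflat φ hφ
  have hFo : IsOpen F.carrier := F.isOpen
  -- Carathéodory: the boundary extension `G`
  set G : ℂ → ℂ := φ.boundaryExtension with hG_def
  have hGc : ContinuousOn G (closure upperHalfPlaneSet) :=
    JordanDomain.continuousOn_boundaryExtension_holds F.toJordanDomain φ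
  have h0cl : (0 : ℂ) ∈ closure upperHalfPlaneSet :=
    (mem_closure_upperHalfPlaneSet_iff).2 (by simp)
  have hG0 : G 0 = 0 := by
    have h := φ.boundaryExtension_eq_of_hasBoundaryValue h0cl hφ.1
    rwa [hpt] at h
  have hGfront : ∀ t : ℝ, G t ∈ frontier F.carrier := fun t ↦ by
    obtain ⟨p, hp, hbv⟩ := JordanDomain.exists_hasBoundaryValue_holds F.toJordanDomain φ t
    have htcl : (t : ℂ) ∈ closure upperHalfPlaneSet :=
      (mem_closure_upperHalfPlaneSet_iff).2 (by simp)
    rw [hG_def, φ.boundaryExtension_eq_of_hasBoundaryValue htcl hbv]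
    exact hp
  have hGφ : ∀ z ∈ upperHalfPlaneSet, G z = φ z := fun z hz ↦ φ.boundaryExtension_eq hz
  -- a half-disc on which `G` stays in `B(0, r₀)`
  obtain ⟨r, hr0, hr⟩ : ∃ r > 0, ball (0 : ℂ) r ∩ closure upperHalfPlaneSet ⊆ G ⁻¹' ball 0 r₀ := by
    have h := hGc 0 h0cl
    rw [ContinuousWithinAt, hG0] at h
    exact Metric.mem_nhdsWithin_iff.1 (h (ball_mem_nhds 0 hr₀))
  set W := upperHalfPlaneSet ∩ ball (0 : ℂ) r with hW_def
  have hφW : ∀ z ∈ W, φ z ∈ upperHalfPlaneSet ∩ ball (0 : ℂ) r₀ := fun z hz ↦ by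
    rw [← hflat]
    refine ⟨φ.mapsTo hz.1, ?_⟩
    have h := hr ⟨hz.2, subset_closure hz.1⟩
    rwa [mem_preimage, hGφ z hz.1] at h
  have hGreal : ∀ t : ℝ, |t| < r → (G t).im = 0 := fun t ht ↦ by
    have htball : (t : ℂ) ∈ ball (0 : ℂ) r := by
      rw [mem_ball_zero_iff, Complex.norm_real, Real.norm_eq_abs]; exact ht
    have htcl : (t : ℂ) ∈ closure upperHalfPlaneSet :=
      (mem_closure_upperHalfPlaneSet_iff).2 (by simp)
    exact im_eq_zero_of_mem_frontier_of_inter_ball_eq hFo hflat (hGfront t) (hr ⟨htball, htcl⟩)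
  -- `G` folded along the real axis (globally continuous) and its Schwarz reflection `Fr`
  set Gt : ℂ → ℂ := fun z ↦ G ((z.re : ℂ) + ((|z.im| : ℝ) : ℂ) * I) with hGt_def
  have hGtc : Continuous Gt := by
    refine hGc.comp_continuous (f := fun z : ℂ ↦ (z.re : ℂ) + ((|z.im| : ℝ) : ℂ) * I)
      (by fun_prop) fun z ↦ ?_
    rw [mem_closure_upperHalfPlaneSet_iff]
    simp
  have hGt_of_nonneg : ∀ z : ℂ, 0 ≤ z.im → Gt z = G z := fun z hz ↦ by
    have hz' : (z.re : ℂ) + ((|z.im| : ℝ) : ℂ) * I = z :=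
      Complex.ext (by simp) (by simp [abs_of_nonneg hz])
    simp only [hGt_def, hz']
  have hGtW : ∀ z ∈ W, Gt z = φ z := fun z hz ↦ by
    rw [hGt_of_nonneg z (le_of_lt hz.1), hGφ z hz.1]
  have hWo : IsOpen W := isOpen_upperHalfPlaneSet.inter isOpen_ball
  have hGtd : DifferentiableOn ℂ Gt W := by
    intro z hz
    have hφd : DifferentiableAt ℂ φ z :=
      φ.differentiableOn_coe.differentiableAt (isOpen_upperHalfPlaneSet.mem_nhds hz.1)
    have hev : (φ : ℂ → ℂ) =ᶠ[𝓝 z] Gt := by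
      filter_upwards [hWo.mem_nhds hz] with w hw
      exact (hGtW w hw).symm
    exact (hev.differentiableAt_iff.1 hφd).differentiableWithinAt
  have hGtreal : ∀ t : ℝ, |t| < r → (Gt t).im = 0 := fun t ht ↦ by
    rw [hGt_of_nonneg t (by simp)]; exact hGreal t ht
  set Fr : ℂ → ℂ := fun z ↦ if 0 ≤ z.im then Gt z else conj (Gt (conj z)) with hFr_def
  have hFr : DifferentiableOn ℂ Fr (ball (0 : ℂ) r) :=
    SchwarzReflection.differentiableOn_reflect hGtc hGtd hGtreal
  have hFr0 : Fr 0 = 0 := by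
    simp [hFr_def, hGt_of_nonneg 0 (by simp), hG0]
  have hFrt : ∀ t : ℝ, Fr t = Gt t := fun t ↦ by simp [hFr_def]
  have hFrW : ∀ z ∈ W, Fr z = φ z := fun z hz ↦ by
    have hz' : 0 < z.im := hz.1
    rw [hFr_def]
    simp only [if_pos hz'.le]
    exact hGtW z hz
  have hFrlow : ∀ z : ℂ, z.im < 0 → Fr z = conj (Gt (conj z)) := fun z hz ↦ by
    rw [hFr_def]; simp only [if_neg (not_le.2 hz)]
  have hFrreal : ∀ t : ℝ, |t| < r → (Fr t).im = 0 := fun t ht ↦ by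
    rw [hFrt]; exact hGtreal t ht
  have hFrpos : ∀ z ∈ W, 0 < (Fr z).im := fun z hz ↦ by
    rw [hFrW z hz]; exact (hφW z hz).1
  have hFrneg : ∀ z ∈ ball (0 : ℂ) r, z.im < 0 → (Fr z).im < 0 := fun z hz hzim ↦ by
    have hcz : conj z ∈ W := by
      refine ⟨?_, ?_⟩
      · show 0 < (conj z).im
        rw [Complex.conj_im]; linarith
      · rw [mem_ball_zero_iff, Complex.norm_conj]; exact mem_ball_zero_iff.1 hz
    rw [hFrlow z hzim, Complex.conj_im, neg_lt_zero]
    have h := hFrpos _ hcz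
    rw [hFr_def] at h
    simp only [if_pos (le_of_lt (show 0 < (conj z).im from hcz.1))] at h
    exact h
  -- the derivative `d = Fr'(0)`: nonzero, real, with nonnegative real part
  set d : ℂ := deriv Fr 0 with hd_def
  have hd : d ≠ 0 ∧ d.im = 0 := by
    have h := deriv_reflection_real hFr hFrreal hFrpos (t := 0) (by simpa using hr0)
    simpa only [ofReal_zero] using h
  have hderiv : HasDerivAt Fr d 0 := (hFr.differentiableAt (ball_mem_nhds 0 hr0)).hasDerivAt
  have hslope : Tendsto (fun z ↦ Fr z / z) (𝓝[≠] 0) (𝓝 d) := by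
    refine (hasDerivAt_iff_tendsto_slope.1 hderiv).congr' (Eventually.of_forall fun z ↦ ?_)
    rw [slope_def_field, hFr0, sub_zero, sub_zero]
  have hHle : 𝓝[upperHalfPlaneSet] (0 : ℂ) ≤ 𝓝[≠] 0 := by
    refine nhdsWithin_mono _ fun z hz h0 ↦ ?_
    have h0' : z = 0 := h0
    have him : 0 < z.im := hz
    rw [h0', zero_im] at him
    exact lt_irrefl _ him
  have hWmem : W ∈ 𝓝[upperHalfPlaneSet] (0 : ℂ) :=
    inter_mem_nhdsWithin upperHalfPlaneSet (ball_mem_nhds 0 hr0)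
  have hlim : Tendsto (fun z ↦ φ z / z) (𝓝[upperHalfPlaneSet] 0) (𝓝 d) := by
    refine (hslope.mono_left hHle).congr' ?_
    filter_upwards [hWmem] with z hz
    rw [hFrW z hz]
  -- `0 ≤ re d`: approach along the imaginary axis
  have hIt : Tendsto (fun t : ℝ ↦ I * t) (𝓝[>] 0) (𝓝[upperHalfPlaneSet] 0) := by
    refine tendsto_nhdsWithin_of_tendsto_nhds_of_eventually_within _ ?_ ?_
    · have : Continuous fun t : ℝ ↦ I * (t : ℂ) := by fun_prop
      simpa using (this.tendsto 0).mono_left nhdsWithin_le_nhds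
    · filter_upwards [self_mem_nhdsWithin] with t ht0
      have ht0' : 0 < t := ht0
      show 0 < (I * (t : ℂ)).im
      simpa using ht0'
  have hre : Tendsto (fun t : ℝ ↦ (φ (I * t) / (I * t)).re) (𝓝[>] 0) (𝓝 d.re) :=
    (continuous_re.tendsto d).comp (hlim.comp hIt)
  have hnonneg : ∀ᶠ t : ℝ in 𝓝[>] 0, (φ (I * t) / (I * t)).re ∈ Ici (0 : ℝ) := by
    filter_upwards [hIt.eventually_mem hWmem, self_mem_nhdsWithin] with t htW ht0
    have ht0' : 0 < t := ht0
    have hposim : 0 < (φ (I * t)).im := (hφW _ htW).1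
    have heq : (φ (I * t) / (I * t)).re = (φ (I * t)).im / t := by
      have ht' : (t : ℂ) ≠ 0 := ofReal_ne_zero.2 ht0'.ne'
      rw [div_re]
      simp [normSq_apply]
      field_simp
    rw [heq]
    exact div_nonneg hposim.le ht0'.le
  have hdre : 0 ≤ d.re := isClosed_Ici.mem_of_tendsto hre hnonneg
  have hdpos : 0 < d.re := by
    rcases hdre.lt_or_eq with h | h
    · exact h
    · exact absurd (Complex.ext (by simpa using h.symm) (by simpa using hd.2)) hd.1
  have hcd : ((d.re : ℝ) : ℂ) = d := Complex.ext (by simp) (by simp [hd.2])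
  -- the local inverse of `Fr` at `0`
  have hstrict : HasStrictDerivAt Fr d 0 := (hFr.analyticAt (ball_mem_nhds 0 hr0)).hasStrictDerivAt
  set g : ℂ → ℂ := hstrict.localInverse Fr d 0 hd.1 with hg_def
  have hg_strict : HasStrictDerivAt g d⁻¹ 0 := by
    have h := hstrict.to_localInverse hd.1
    rwa [hFr0] at h
  have hg_right : ∀ᶠ w in 𝓝 (0 : ℂ), Fr (g w) = w := by
    have h := hstrict.eventually_right_inverse hd.1
    rwa [hFr0] at h
  have hg_tend : Tendsto g (𝓝 (0 : ℂ)) (𝓝 0) := by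
    have h := (hstrict.hasStrictFDerivAt_equiv hd.1).localInverse_tendsto
    rwa [hFr0] at h
  have hg0 : g 0 = 0 := by
    have h := (hstrict.hasStrictFDerivAt_equiv hd.1).localInverse_apply_image
    rwa [hFr0] at h
  -- `φ⁻¹ = g` on `F` near `0`
  have hsymm_eq : ∀ᶠ w in 𝓝[F.carrier] 0, φ.symm w = g w := by
    have hev : ∀ᶠ w in 𝓝 (0 : ℂ), Fr (g w) = w ∧ g w ∈ ball (0 : ℂ) r ∧ w ∈ ball (0 : ℂ) r₀ :=
      hg_right.and ((hg_tend.eventually_mem (ball_mem_nhds 0 hr0)).and (ball_mem_nhds 0 hr₀))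
    filter_upwards [mem_nhdsWithin_of_mem_nhds hev, self_mem_nhdsWithin] with w hw hwF
    obtain ⟨h1, h2, h3⟩ := hw
    have hwH : 0 < w.im := by
      have : w ∈ upperHalfPlaneSet ∩ ball (0 : ℂ) r₀ := by
        rw [← hflat]; exact ⟨hwF, h3⟩
      exact this.1
    have hζH : 0 < (g w).im := by
      rcases lt_trichotomy (g w).im 0 with hlt | heq | hgt
      · exfalso
        have h := hFrneg (g w) h2 hlt
        rw [h1] at h
        exact lt_irrefl _ (h.trans hwH)
      · exfalso
        have hre : |(g w).re| < r := by
          have h1' : |(g w).re| ≤ ‖g w‖ := Complex.abs_re_le_norm _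
          exact lt_of_le_of_lt h1' (mem_ball_zero_iff.1 h2)
        have hgw : g w = ((g w).re : ℂ) := Complex.ext (by simp) (by simp [heq])
        have h := hFrreal (g w).re hre
        rw [← hgw, h1] at h
        rw [h] at hwH
        exact lt_irrefl _ hwH
      · exact hgt
    have hφζ : φ (g w) = w := by rw [← hFrW (g w) ⟨hζH, h2⟩, h1]
    calc φ.symm w = φ.symm (φ (g w)) := by rw [hφζ]
      _ = g w := φ.symm_apply_apply hζH
  have hslope_g : Tendsto (fun w ↦ g w / w) (𝓝[≠] 0) (𝓝 d⁻¹) := by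
    refine (hasDerivAt_iff_tendsto_slope.1 hg_strict.hasDerivAt).congr'
      (Eventually.of_forall fun w ↦ ?_)
    rw [slope_def_field, hg0, sub_zero, sub_zero]
  have h0F : (0 : ℂ) ∉ F.carrier := fun h ↦ by
    have : (0 : ℂ) ∈ upperHalfPlaneSet ∩ ball (0 : ℂ) r₀ := by
      rw [← hflat]; exact ⟨h, mem_ball_self hr₀⟩
    have him : (0 : ℝ) < (0 : ℂ).im := this.1
    simp at him
  have hFle : 𝓝[F.carrier] (0 : ℂ) ≤ 𝓝[≠] 0 :=
    nhdsWithin_mono _ fun w hw h0 ↦ h0F ((mem_singleton_iff.1 h0) ▸ hw)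
  have hlim_symm : Tendsto (fun w ↦ φ.symm w / w) (𝓝[F.carrier] 0) (𝓝 d⁻¹) :=
    (hslope_g.mono_left hFle).congr' (by filter_upwards [hsymm_eq] with w hw; rw [hw])
  refine ⟨d.re, hdpos, ?_, ?_⟩
  · rw [hcd]; exact hlim
  · rw [hcd]; exact hlim_symm

end Summit.CriticalPhenomena.SAWScalingLimit.Cruxes.HexTransfer.PinTheShear
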